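import Mathlib

/-!
# Crux `FeketeSOS.SOSMagnification` (stmt-ValiantsHypothesis-3995) — Negative lemmas of the standing disprover,
# cycle 5: the radix threshold of the polarised count, and the `p = 2` exception of the Euler test

Line `sml-polarised-transport` (all seven stubs landed as `Theorems/FeketeSOSSOSMagnificationStub*.lean`) feeds the
hardness hypothesis X a representation with `s ≤ 2^{n+1}·T` squares of `≤ k^{⌊n/2⌋} + k^{n−⌊n/2⌋}` monomials each,
radix `k = n + 1`, against the threshold `p^{1/2+δ}`, `p ≤ k^n` (`stub_budget` (b)).  NATURAL STRENGTHENING REFUTED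
("the transport runs with binary / bounded digits"): for radix `2`, and for every fixed radix `k` with `k^δ ≤ 2`, the
inequality (b) is FALSE at every level `n`, for every cut length `T ≥ 1` — the polarisation factor `2^{n+1}` must be
beaten by `k^{δ n}`, so the count needs `k > 2^{1/δ}` (growing radix, as landed, or a `δ`-dependent fixed one; compare
DST24's `k ≥ 6^{1/δ} + 1` for the binomial count).  Also recorded: why `pSel n ≠ 2` is load-bearing in the landed V-half
(`stub_vnpAssembly`): at `p = 2` Euler's test `m^{p/2} = −1` fires for odd `m` while the Legendre symbol never takes the
value `−1`.  Companion of `Cruxes/SOSMagnification/Disproof.lean` §Cycle 5 (finding 30).  [folklore]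
-/

set_option linter.dupNamespace false

namespace Summit.ValiantsHypothesis.ValiantsHypothesis.Theorems.SOSMagnification.Negative


/-- radix 2 never runs the polarised line: the budget inequality (b) of `stub_budget` with binary digits
(`n+1 ↦ 2` as radix, `p ≤ 2^n`) is FALSE at every level, for every `0 < δ ≤ 1` and every cut length `T ≥ 1`. -/
theorem radix_two_budget_fails {δ : ℝ} (hδ₀ : 0 < δ) (hδ₁ : δ ≤ 1) (n T p : ℕ) (hT : 1 ≤ T)
    (hp : p ≤ 2 ^ n) :
    (p : ℝ) ^ (1 / 2 + δ) ≤ ((2 ^ (n + 1) * T * (2 ^ (n / 2) + 2 ^ (n - n / 2)) : ℕ) : ℝ) := by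
  have h1 : (p : ℝ) ^ (1 / 2 + δ) ≤ ((2 : ℝ) ^ n) ^ (1 / 2 + δ) :=
    Real.rpow_le_rpow (by positivity) (by exact_mod_cast hp) (by linarith)
  have h2 : ((2 : ℝ) ^ n) ^ (1 / 2 + δ) ≤ ((2 : ℝ) ^ n) ^ ((3 : ℝ) / 2) :=
    Real.rpow_le_rpow_of_exponent_le (one_le_pow₀ (by norm_num)) (by linarith)
  have h3 : ((2 : ℝ) ^ n) ^ ((3 : ℝ) / 2) ≤ (2 : ℝ) ^ (n + 1 + (n - n / 2)) := by
    rw [← Real.rpow_natCast (2 : ℝ) n, ← Real.rpow_mul (by norm_num),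
      ← Real.rpow_natCast (2 : ℝ) (n + 1 + (n - n / 2))]
    apply Real.rpow_le_rpow_of_exponent_le (by norm_num)
    have hdiv : (n / 2) * 2 ≤ n := Nat.div_mul_le_self n 2
    have hsub : ((n - n / 2 : ℕ) : ℝ) = (n : ℝ) - ((n / 2 : ℕ) : ℝ) := by
      rw [Nat.cast_sub (Nat.div_le_self n 2)]
    have hcast : (((n / 2 : ℕ) : ℝ)) * 2 ≤ (n : ℝ) := by exact_mod_cast hdiv
    rw [Nat.cast_add, Nat.cast_add, hsub]
    push_cast
    linarith
  have h4 : (2 : ℝ) ^ (n + 1 + (n - n / 2)) ≤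
      ((2 ^ (n + 1) * T * (2 ^ (n / 2) + 2 ^ (n - n / 2)) : ℕ) : ℝ) := by
    have h : 2 ^ (n + 1 + (n - n / 2)) ≤ 2 ^ (n + 1) * T * (2 ^ (n / 2) + 2 ^ (n - n / 2)) :=
      calc 2 ^ (n + 1 + (n - n / 2)) = 2 ^ (n + 1) * 1 * 2 ^ (n - n / 2) := by rw [pow_add, mul_one]
        _ ≤ 2 ^ (n + 1) * T * (2 ^ (n / 2) + 2 ^ (n - n / 2)) :=
          Nat.mul_le_mul (Nat.mul_le_mul le_rfl hT) (Nat.le_add_left _ _)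
    exact_mod_cast h
  linarith

/-- … while ANY fixed radix `k ≥ 2` with `k^δ ≤ 2` fails the same way (so the count needs `k > 2^{1/δ}`):
with `p ≤ k^n`, `p^{1/2+δ} ≤ k^{n/2}·(k^δ)^n ≤ k^{n/2}·2^n ≤ 2^{n+1}·T·(k^{⌊n/2⌋} + k^{n-⌊n/2⌋})`. -/
theorem fixed_radix_budget_fails {δ : ℝ} (hδ₀ : 0 < δ) (k n T p : ℕ) (hk : 2 ≤ k)
    (hkδ : (k : ℝ) ^ δ ≤ 2) (hT : 1 ≤ T) (hp : p ≤ k ^ n) :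
    (p : ℝ) ^ (1 / 2 + δ) ≤ ((2 ^ (n + 1) * T * (k ^ (n / 2) + k ^ (n - n / 2)) : ℕ) : ℝ) := by
  have hk0 : (0 : ℝ) < k := by exact_mod_cast (lt_of_lt_of_le (by norm_num) hk)
  have hk1 : (1 : ℝ) ≤ k := by exact_mod_cast (le_trans (by norm_num) hk)
  -- p^{1/2+δ} ≤ (k^n)^{1/2+δ} = (k^n)^{1/2} (k^δ)^n ≤ (k^n)^{1/2} 2^n
  have h1 : (p : ℝ) ^ (1 / 2 + δ) ≤ ((k : ℝ) ^ n) ^ (1 / 2 + δ) :=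
    Real.rpow_le_rpow (by positivity) (by exact_mod_cast hp) (by linarith)
  have h2 : ((k : ℝ) ^ n) ^ (1 / 2 + δ) = ((k : ℝ) ^ n) ^ (1 / 2 : ℝ) * ((k : ℝ) ^ δ) ^ n := by
    rw [Real.rpow_add (by positivity)]
    congr 1
    rw [← Real.rpow_natCast_mul hk0.le, mul_comm, Real.rpow_mul_natCast hk0.le]
  have h3 : ((k : ℝ) ^ δ) ^ n ≤ (2 : ℝ) ^ n :=
    pow_le_pow_left₀ (by positivity) hkδ n
  -- (k^n)^{1/2} ≤ k^{n - n/2}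
  have h4 : ((k : ℝ) ^ n) ^ (1 / 2 : ℝ) ≤ (k : ℝ) ^ (n - n / 2) := by
    rw [← Real.rpow_natCast_mul hk0.le, ← Real.rpow_natCast (k : ℝ) (n - n / 2)]
    apply Real.rpow_le_rpow_of_exponent_le hk1
    have hdiv : (n / 2) * 2 ≤ n := Nat.div_mul_le_self n 2
    have hcast : (((n / 2 : ℕ) : ℝ)) * 2 ≤ (n : ℝ) := by exact_mod_cast hdiv
    rw [Nat.cast_sub (Nat.div_le_self n 2)]
    linarith
  have h5 : ((k : ℝ) ^ n) ^ (1 / 2 : ℝ) * ((k : ℝ) ^ δ) ^ n ≤ (k : ℝ) ^ (n - n / 2) * (2 : ℝ) ^ n :=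
    mul_le_mul h4 h3 (by positivity) (by positivity)
  have h6 : (k : ℝ) ^ (n - n / 2) * (2 : ℝ) ^ n ≤
      ((2 ^ (n + 1) * T * (k ^ (n / 2) + k ^ (n - n / 2)) : ℕ) : ℝ) := by
    have h : k ^ (n - n / 2) * 2 ^ n ≤ 2 ^ (n + 1) * T * (k ^ (n / 2) + k ^ (n - n / 2)) :=
      calc k ^ (n - n / 2) * 2 ^ n = 2 ^ n * 1 * k ^ (n - n / 2) := by ring
        _ ≤ 2 ^ (n + 1) * T * (k ^ (n / 2) + k ^ (n - n / 2)) :=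
          Nat.mul_le_mul (Nat.mul_le_mul (Nat.pow_le_pow_right (by norm_num) (Nat.le_succ n)) hT)
            (Nat.le_add_left _ _)
    exact_mod_cast h
  calc (p : ℝ) ^ (1 / 2 + δ) ≤ ((k : ℝ) ^ n) ^ (1 / 2 + δ) := h1
    _ = ((k : ℝ) ^ n) ^ (1 / 2 : ℝ) * ((k : ℝ) ^ δ) ^ n := h2
    _ ≤ (k : ℝ) ^ (n - n / 2) * (2 : ℝ) ^ n := h5
    _ ≤ _ := h6

/-- `pSel n ≠ 2` is load-bearing for the landed V-half: at `p = 2` the Legendre specification can never ask for the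
value `−1` … -/
theorem legendreSym_two_ne_neg_one (m : ℤ) : legendreSym 2 m ≠ -1 := by
  by_cases h : (m : ZMod 2) = 0
  · rw [(legendreSym.eq_zero_iff 2 m).2 h]; decide
  · unfold legendreSym
    rw [quadraticChar_eq_one_of_char_two (ZMod.ringChar_zmod_n 2) h]; decide

/-- … while Euler's test `m ^ (p / 2) = −1` (what the Legendre circuit `stub_legendreCircuit` decides) FIRES at `p = 2`
for odd `m`, since `−1 = 1` in `ZMod 2`. -/
theorem euler_test_fires_at_two : ((1 : ℕ) : ZMod 2) ^ (2 / 2) = -1 := by decide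

end Summit.ValiantsHypothesis.ValiantsHypothesis.Theorems.SOSMagnification.Negative
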